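import Literature.AlgebraicGeometry.HodgeTheory.FermatClaimPermutationInvariance
import Literature.AlgebraicGeometry.HodgeTheory.FermatShiodaCondition
import Literature.AlgebraicGeometry.HodgeTheory.ShiodaClaimPairedProofs
import HarnessLib

/-!
# Aoki's claim as a predicate on multisets of residues; Shioda's inductive spine on the real carriers

Family `hodge`, layer `Literature/AlgebraicGeometry/HodgeTheory`. Proof file (everything PROVED, no
named fact introduced) wiring the named fact `Aoki1987_claim_juxtaposition` of
`FermatInductiveClaims` (Aoki, J. Math. Soc. Japan 39 (1987) Thm. 1-4 (i); Shioda, Math. Ann. 245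
(1979) Thm. I) to its Literature consumer, the combinatorial spine of Shioda's Theorem 1
(`FermatCharacter.IsShiodaClosed`, `IsShiodaClosed.of_shiodaCondition` of `FermatShiodaCondition`;
Shioda, Proc. Japan Acad. 55A (1979) §2 Thm. 1 with §4; da Silva, arXiv:2101.04739, Thm. 2.5), whose
intended instance "`C = 𝔠ₘ`, the Hodge characters up to permutation whose eigenspace consists of
classes of algebraic cycles" had so far only been described in prose:

* `FermatCharacter.ClaimMultiset m s` — **claim for a multiset `s` of residues mod `m`**: every
  character `α` of every `X²ʳₘ` with multiset of values `s` satisfies claim(α)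
  (`V(α) ⊆ algebraicClasses`). Since claim(α) depends only on the multiset of values
  (`FermatCharacter.Claim.of_univ_val_map_eq`: the symmetric group acts on `Xⁿₘ`) and the multiset
  determines `r`, `ClaimMultiset m (univ.val.map α) ↔ Claim m r α` (`claimMultiset_univ_val_map_iff`):
  this IS Shioda's `𝔠ₘ` as a predicate on `Mₘ`.
* `ClaimMultiset.pair` — dimension `0` (`{a, -a}`, `X⁰ₘ`): every class is algebraic.
* `ClaimMultiset.star_of_juxtaposition` — **the `star` (type II) closure property of `𝔠ₘ` is exactly
  the named fact `Aoki1987_claim_juxtaposition`** (Hodge multisets `t, u ≠ 0` in `𝔠ₘ` ⟹ `t + u ∈ 𝔠ₘ`: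
  realise `t`, `u` as Hodge characters of `X²ᵃₘ`, `X²ᵇₘ` — a non-empty Hodge multiset has even
  cardinality `≥ 2` — and any character with multiset `t + u` lives on `X^{2(a+b+1)}ₘ`).
* `ClaimMultiset.surface_of_claim_one` — the `surface` field from claim for the Hodge characters of
  the Fermat surface `X²ₘ` (Lefschetz `(1,1)`; an input, not proved here).
* `isShiodaClosed_claimMultiset` — `IsShiodaClosed (ClaimMultiset m)` from the named fact plus the
  three remaining printed inputs taken as hypotheses in the exact shape of the fields (`surface`:
  Lefschetz `(1,1)` on `X²ₘ`; `semi`: the semi-decomposable characters of `X⁴ₘ`; `hash`: the type-I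
  summand, da Silva Cor. 2.3 (b)) — none of which is a named fact of the tree.
* `FermatCharacter.claim_of_shiodaCondition`, `claim_of_shiodaConditionUpTo` — **Shioda's Theorem 1
  on the real carriers**: under `(Pₘ)` (resp. `(Pⁿₘ)`), granted the four closure inputs, claim(α) holds
  for EVERY Hodge character `α` of every `X²ᵖₘ` (resp. `2p ≤ n`) — literally the hypothesis `hB` of
  `mem_algebraicClasses_fermat_middle_of_eigenspaces` (`FermatHodgeConjectureAssembly`), the
  middle-degree assembly of the named fact `hodgeClasses_algebraic_fermat`.

## References

* [Shioda1979PJA] T. Shioda, The Hodge conjecture and the Tate conjecture for Fermat varieties,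
  Proc. Japan Acad. 55A (1979) 111–114, §2 Thm. 1 and §4 (text read).
* [daSilva2021HodgeFermat] G. da Silva Jr., arXiv:2101.04739, Thm. 2.2, Cor. 2.3, Thm. 2.5 (text read).
* [Aoki1987] N. Aoki, J. Math. Soc. Japan 39 (1987) 385–396, Thm. 1-4 (i) (p. 388) (text read).
-/

noncomputable section

open Finset

namespace Literature.AlgebraicGeometry.HodgeTheory

namespace FermatCharacter

variable {m : ℕ}

/-! ### Claim for a multiset of residues: Shioda's `𝔠ₘ` as a predicate -/

/-- **Claim for a multiset `s` of residues mod `m`** (Shioda's "`ξ ∈ 𝔠ₘ`"): every character `α` of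
every `X²ʳₘ` whose multiset of values is `s` satisfies claim(α), i.e. its eigenspace
`V(α) ⊆ H²ʳ(X²ʳₘ(ℂ); ℂ)` consists of algebraic classes. (Only `r` with `2r + 2 = #s` can occur.)
[cite: Shioda1979PJA, §4 (the set of α for which V(α) is algebraic)] [cite: daSilva2021HodgeFermat, §2 (ℭⁿₘ)] -/
def ClaimMultiset (m : ℕ) (s : Multiset (ZMod m)) : Prop :=
  ∀ (r : ℕ) (α : Fin (2 * r + 2) → ZMod m), univ.val.map α = s → Claim m r α

/-- Unfolding `ClaimMultiset` at a character. [folklore] -/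
theorem ClaimMultiset.claim {s : Multiset (ZMod m)} (h : ClaimMultiset m s) {r : ℕ}
    {α : Fin (2 * r + 2) → ZMod m} (hα : univ.val.map α = s) : Claim m r α :=
  h r α hα

/-- **`ClaimMultiset m (univ.val.map α) ↔ Claim m r α`**: claim depends only on the multiset of values
(`Claim.of_univ_val_map_eq`, the symmetric group acting on `X²ʳₘ`), and the multiset has `2r + 2`
elements, which pins down `r`. [cite: Aoki1987, §1 ("α ∼ β")] [cite: Shioda1979PJA, §4] -/
theorem claimMultiset_univ_val_map_iff [NeZero m] {r : ℕ} (α : Fin (2 * r + 2) → ZMod m) :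
    ClaimMultiset m (univ.val.map α) ↔ Claim m r α := by
  refine ⟨fun h ↦ h r α rfl, fun h r' α' hα' ↦ ?_⟩
  have hc := congrArg Multiset.card hα'
  rw [card_univ_val_map, card_univ_val_map] at hc
  obtain rfl : r' = r := by omega
  exact h.of_univ_val_map_eq hα'

/-- A multiset realised by a character of `X²ʳₘ` has `2r + 2` elements. [folklore] -/
theorem card_eq_of_univ_val_map_eq {r : ℕ} {α : Fin (2 * r + 2) → ZMod m} {s : Multiset (ZMod m)}
    (hα : univ.val.map α = s) : Multiset.card s = 2 * r + 2 := by
  rw [← hα, card_univ_val_map]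

/-- **A non-empty Hodge multiset is the multiset of values of a Hodge character of some `X²ᵃₘ`**
(its cardinality is even and at least `2`). [cite: Shioda1979PJA, §1 and §2 ("n is even")] -/
theorem IsHodgeMultiset.exists_isHodge_even [NeZero m] {s : Multiset (ZMod m)} (hs : IsHodgeMultiset s)
    (hs0 : s ≠ 0) : ∃ (a : ℕ) (α : Fin (2 * a + 2) → ZMod m), IsHodge α ∧ univ.val.map α = s := by
  obtain ⟨k, α, hα, rfl⟩ := hs.exists_isHodge
  obtain ⟨j, hj⟩ := hs.even_card
  have h2 := hs.two_le_card hs0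
  rw [card_univ_val_map] at hj h2
  obtain ⟨a, rfl⟩ : ∃ a, k = 2 * a + 2 := ⟨j - 1, by omega⟩
  exact ⟨a, α, hα, rfl⟩

/-! ### The closure properties of `𝔠ₘ` -/

/-- **Dimension `0`**: the pairs `{a, -a}` (the Hodge characters of `X⁰ₘ`, `m` points) are in `𝔠ₘ` —
in codimension `0` every class is algebraic (`claim_zero`). [cite: daSilva2021HodgeFermat, §2 ("true for n ≤ 2")] -/
theorem ClaimMultiset.pair (a : ZMod m) : ClaimMultiset m {a, -a} := by
  intro r α hα
  have hc := card_eq_of_univ_val_map_eq hα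
  simp only [Multiset.insert_eq_cons, Multiset.card_cons, Multiset.card_singleton] at hc
  obtain rfl : r = 0 := by omega
  exact claim_zero m α

/-- **The type-II closure of `𝔠ₘ` is the named fact `Aoki1987_claim_juxtaposition`**: for non-empty
Hodge multisets `t, u ∈ 𝔠ₘ` also `t + u ∈ 𝔠ₘ` — realise `t`, `u` by Hodge characters `α`, `β` of
`X²ᵃₘ`, `X²ᵇₘ` (`IsHodgeMultiset.exists_isHodge_even`); a character `γ` with multiset `t + u` has
`2(a + b + 1) + 2` coordinates, and claim(γ) is Thm. 1-4 (i) up to permutation.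
[cite: Aoki1987, Thm. 1-4 (i), p. 388] [cite: daSilva2021HodgeFermat, Cor. 2.3 (a)] -/
theorem ClaimMultiset.star_of_juxtaposition [NeZero m] (h : Aoki1987_claim_juxtaposition)
    {t u : Multiset (ZMod m)} (ht0 : t ≠ 0) (hu0 : u ≠ 0) (ht : IsHodgeMultiset t) (hu : IsHodgeMultiset u)
    (hct : ClaimMultiset m t) (hcu : ClaimMultiset m u) : ClaimMultiset m (t + u) := by
  intro r γ hγ
  obtain ⟨a, α, hα, rfl⟩ := ht.exists_isHodge_even ht0
  obtain ⟨b, β, hβ, rfl⟩ := hu.exists_isHodge_even hu0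
  have hc := card_eq_of_univ_val_map_eq hγ
  rw [Multiset.card_add, card_univ_val_map, card_univ_val_map] at hc
  obtain rfl : r = a + b + 1 := by omega
  exact h m a b α β γ hα hβ hγ (hct.claim rfl) (hcu.claim rfl)

/-- **The `surface` closure from claim on the Fermat surface**: if claim(α) holds for every Hodge
character `α` of `X²ₘ` (Lefschetz's theorem on `(1,1)`-classes — an input here), every Hodge
multiset with `4` elements is in `𝔠ₘ`. [cite: daSilva2021HodgeFermat, §2 ("true for n ≤ 2")] -/
theorem ClaimMultiset.surface_of_claim_one
    (h1 : ∀ α : Fin (2 * 1 + 2) → ZMod m, IsHodge α → Claim m 1 α)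
    {s : Multiset (ZMod m)} (hs : IsHodgeMultiset s) (h4 : Multiset.card s = 4) : ClaimMultiset m s := by
  intro r α hα
  have hc := card_eq_of_univ_val_map_eq hα
  obtain rfl : r = 1 := by omega
  refine h1 α ((isHodge_iff_isHodgeMultiset α).2 ?_)
  rwa [hα]

/-- **`𝔠ₘ` is closed under the inductive structure of Fermat varieties**, granted, besides the named
fact `Aoki1987_claim_juxtaposition` (the `star` field) and the trivial dimension `0` (`pair`), the
three remaining printed inputs, taken as hypotheses in the shape of the fields of
`IsShiodaClosed`: `h1` — claim for the Hodge characters of the Fermat SURFACE `X²ₘ` (Lefschetz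
`(1,1)`); `hsemi` — the semi-decomposable Hodge characters of `X⁴ₘ` (`X¹ₘ × X¹ₘ` and the type-II
map); `hhash` — the type-I summand (da Silva Cor. 2.3 (b)). None of the three is a named fact of the
tree; they are the next inputs of Shioda's Theorem 1 on the real carriers.
[cite: Shioda1979PJA, §4 (the isomorphism (*) "which preserves algebraic cycles")]
[cite: daSilva2021HodgeFermat, Thm. 2.2 and Cor. 2.3] -/
theorem isShiodaClosed_claimMultiset [NeZero m] (hjux : Aoki1987_claim_juxtaposition)
    (h1 : ∀ α : Fin (2 * 1 + 2) → ZMod m, IsHodge α → Claim m 1 α)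
    (hsemi : ∀ s : Multiset (ZMod m), IsHodgeMultiset s → IsSemiDecomposable s → ClaimMultiset m s)
    (hhash : ∀ (e : ZMod m) (t u : Multiset (ZMod m)), IsHodgeMultiset (e ::ₘ t) →
      IsHodgeMultiset ((-e) ::ₘ u) → IsHodgeMultiset (t + u) → 4 ≤ Multiset.card (e ::ₘ t) →
        4 ≤ Multiset.card ((-e) ::ₘ u) → ClaimMultiset m (e ::ₘ t) → ClaimMultiset m ((-e) ::ₘ u) →
          ClaimMultiset m (t + u)) :
    IsShiodaClosed (ClaimMultiset m) where
  pair a _ := ClaimMultiset.pair a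
  surface _ hs h4 := ClaimMultiset.surface_of_claim_one h1 hs h4
  semi := hsemi
  star _ _ ht0 hu0 ht hu hct hcu := ClaimMultiset.star_of_juxtaposition hjux ht0 hu0 ht hu hct hcu
  hash := hhash

/-! ### Shioda's Theorem 1 on the real carriers -/

/-- **Shioda's Theorem 1 on the tree's carriers (uniform in the dimension).** Under Shioda's
condition `(Pₘ)` and granted the closure inputs of `isShiodaClosed_claimMultiset` (the named fact
`Aoki1987_claim_juxtaposition` and the hypotheses `h1`, `hsemi`, `hhash`), claim(α) holds for
EVERY Hodge character `α ∈ 𝔅²ᵖₘ` of every `X²ᵖₘ`: `V(α) ⊆ algebraicClasses (fermatHypersurface (2p) m) p`.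
This is literally the hypothesis `hB` of `mem_algebraicClasses_fermat_middle_of_eigenspaces`
(`FermatHodgeConjectureAssembly`) for the degree `m`. Proof: the multiset of values of `α` is a
non-empty Hodge multiset, hence in `𝔠ₘ` by the spine `IsShiodaClosed.of_shiodaCondition`.
[cite: Shioda1979PJA, §2 Thm. 1 and §4] [cite: daSilva2021HodgeFermat, Thm. 2.5] -/
theorem claim_of_shiodaCondition [NeZero m] (hP : ShiodaCondition m) (hjux : Aoki1987_claim_juxtaposition)
    (h1 : ∀ α : Fin (2 * 1 + 2) → ZMod m, IsHodge α → Claim m 1 α)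
    (hsemi : ∀ s : Multiset (ZMod m), IsHodgeMultiset s → IsSemiDecomposable s → ClaimMultiset m s)
    (hhash : ∀ (e : ZMod m) (t u : Multiset (ZMod m)), IsHodgeMultiset (e ::ₘ t) →
      IsHodgeMultiset ((-e) ::ₘ u) → IsHodgeMultiset (t + u) → 4 ≤ Multiset.card (e ::ₘ t) →
        4 ≤ Multiset.card ((-e) ::ₘ u) → ClaimMultiset m (e ::ₘ t) → ClaimMultiset m ((-e) ::ₘ u) →
          ClaimMultiset m (t + u))
    {p : ℕ} {α : Fin (2 * p + 2) → ZMod m} (hα : IsHodge α) : Claim m p α := by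
  have hs : IsHodgeMultiset (univ.val.map α) := hα.isHodgeMultiset
  have hs0 : univ.val.map α ≠ 0 := by
    intro h0
    have := congrArg Multiset.card h0
    rw [card_univ_val_map, Multiset.card_zero] at this
    omega
  exact (claimMultiset_univ_val_map_iff α).1
    ((isShiodaClosed_claimMultiset hjux h1 hsemi hhash).of_shiodaCondition hP _ hs0 hs)

/-- **Shioda's Theorem 1 on the tree's carriers, fixed dimension**: under `(Pⁿₘ)` only, the same
conclusion for the Hodge characters of `X²ᵖₘ` with `2p ≤ n` (`IsShiodaClosed.of_shiodaConditionUpTo`).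
[cite: Shioda1979PJA, §2 Thm. 1] [cite: daSilva2021HodgeFermat, Thm. 2.5] -/
theorem claim_of_shiodaConditionUpTo [NeZero m] {n : ℕ} (hP : ShiodaConditionUpTo m n)
    (hjux : Aoki1987_claim_juxtaposition)
    (h1 : ∀ α : Fin (2 * 1 + 2) → ZMod m, IsHodge α → Claim m 1 α)
    (hsemi : ∀ s : Multiset (ZMod m), IsHodgeMultiset s → IsSemiDecomposable s → ClaimMultiset m s)
    (hhash : ∀ (e : ZMod m) (t u : Multiset (ZMod m)), IsHodgeMultiset (e ::ₘ t) →
      IsHodgeMultiset ((-e) ::ₘ u) → IsHodgeMultiset (t + u) → 4 ≤ Multiset.card (e ::ₘ t) →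
        4 ≤ Multiset.card ((-e) ::ₘ u) → ClaimMultiset m (e ::ₘ t) → ClaimMultiset m ((-e) ::ₘ u) →
          ClaimMultiset m (t + u))
    {p : ℕ} (hpn : 2 * p ≤ n) {α : Fin (2 * p + 2) → ZMod m} (hα : IsHodge α) : Claim m p α := by
  have hs : IsHodgeMultiset (univ.val.map α) := hα.isHodgeMultiset
  have hs0 : univ.val.map α ≠ 0 := by
    intro h0
    have := congrArg Multiset.card h0
    rw [card_univ_val_map, Multiset.card_zero] at this
    omega
  refine (claimMultiset_univ_val_map_iff α).1
    ((isShiodaClosed_claimMultiset hjux h1 hsemi hhash).of_shiodaConditionUpTo hP _ hs0 hs ?_)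
  rw [card_univ_val_map]
  omega

end FermatCharacter

end Literature.AlgebraicGeometry.HodgeTheory

end
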